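import Summits.SmoothPoincare4.SmoothPoincare4.Theorems.CylinderEntropyCylinderRungTwoUnitLowerDensity
import Summits.SmoothPoincare4.SmoothPoincare4.Theorems.CylinderEntropyCylinderRungTwoRelaxationOfAreaToFloor
import Summits.SmoothPoincare4.SmoothPoincare4.Theorems.CylinderEntropyCylinderRungTwoKillingFluxDefs
import Literature.Geometry.Riemannian.SphericalCylinderEntropy
import HarnessLib

/-!
# Route `CylinderEntropy`, crux `CylinderRungTwo` (stmt-SmoothPoincare4-7631), line `killing-flux`:
# THE PARABOLIC AREA FLOOR — every slice of an immortal smooth cylinder flow has area `≥ μH⁴(S⁴)`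

Registered helper `helper_volLeAreaAlongCylinderFlow` (lead c6).  Along a smooth mean curvature flow
`IsCylinderMCF M F ν T` of a non-empty closed cross-section of `N = S⁴ × ℝ ⊂ ℝ⁶` — which by the typing of
`IsCylinderMCF` is IMMORTAL (defined for all `t ≥ T`) — every time slice has area at least that of a slice:

  `μH⁴(S⁴) ≤ μH⁴(F_t(M))`   for all `t ≥ T`.

NO separation hypothesis and NO entropy hypothesis enter (contrast the route's static `AreaFloor`,
stmt-SmoothPoincare4-7635, where separation of the ends is what forces the floor).  Equivalently: a closed
hypersurface of `N` of area `< μH⁴(S⁴)` cannot be flowed smoothly forever — it becomes singular (or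
extinct) in finite time; this is the first piece of the long-time bookkeeping of a flow with surgery in `N`
(split-off components of small area are never immortal leaves; cf. `CylNeckSurgeryResolvable.immortal`).

Proof (two landed inputs and a limit): by the UNIT LOWER DENSITY ALONG THE FLOW
(`helper_unitLowerDensityAlongFlow`: Hamilton's monotonicity in `N` + `liminf ≥ 1` at small scales),
`1 ≤ F̂_{F(t+σ)x₀, σ}(F_t(M))` for every lag `σ > 0` and any point `x₀ : M`; by the SOFT LARGE-SCALE BOUND
(`cylDensity_le_one_add_tail_mul`: the typed kernel is `≤ 1 + t(σ)` pointwise for `σ ≥ 1`,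
`t(σ) = e^{-σ}/(1-e^{-σ}) → 0`), `F̂_{p,σ}(F_t(M)) ≤ (1 + t(σ)) μH⁴(F_t(M))/μH⁴(S⁴)`; hence
`μH⁴(S⁴) ≤ (1 + t(σ)) μH⁴(F_t(M))` for all `σ ≥ 1`, and `σ → ∞` gives the claim.  Everything is PROVED
(no `sorry`, no definition, no named fact).

References: R. S. Hamilton, *Monotonicity formulas for parabolic flows on manifolds*, Comm. Anal. Geom. 1
(1993) 127–137, Thm. 4.1; T. H. Colding, W. P. Minicozzi II, *Generic mean curvature flow I*, Ann. of Math.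
175 (2012), Lemma 1.11 and §7.2 (unit density at smooth points).
-/

noncomputable section

-- the prescribed namespace `Summit.SmoothPoincare4.SmoothPoincare4.…` repeats `SmoothPoincare4`
set_option linter.dupNamespace false

open MeasureTheory Set Filter
open scoped Manifold ContDiff ENNReal NNReal Topology BigOperators

namespace Summit.SmoothPoincare4.SmoothPoincare4.Cruxes.CylinderRungTwo.KillingFlux

open Literature.Geometry.Riemannian
open Literature.Geometry.Riemannian.SphericalCylinderEntropy

/-- If `v ≤ ofReal (1 + t σ) * m` for all `σ ≥ 1` and `t σ → 0` as `σ → ∞`, then `v ≤ m` (in `ℝ≥0∞`).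
[folklore] -/
theorem le_of_forall_le_ofReal_one_add_mul {v m : ℝ≥0∞} {t : ℝ → ℝ}
    (ht : Tendsto t atTop (𝓝 0)) (h : ∀ σ : ℝ, 1 ≤ σ → v ≤ ENNReal.ofReal (1 + t σ) * m) : v ≤ m := by
  -- the right-hand side tends to `ofReal 1 * m = m` along `atTop`
  have h1 : Tendsto (fun σ => ENNReal.ofReal (1 + t σ)) atTop (𝓝 (ENNReal.ofReal (1 + 0))) :=
    (ENNReal.continuous_ofReal.tendsto _).comp (tendsto_const_nhds.add ht)
  rw [add_zero, ENNReal.ofReal_one] at h1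
  have h2 : Tendsto (fun σ => ENNReal.ofReal (1 + t σ) * m) atTop (𝓝 (1 * m)) :=
    ENNReal.Tendsto.mul_const h1 (Or.inl one_ne_zero)
  rw [one_mul] at h2
  exact ge_of_tendsto h2 (eventually_atTop.2 ⟨1, fun σ hσ => h σ hσ⟩)

/-- **Registered helper `helper_volLeAreaAlongCylinderFlow` — THE PARABOLIC AREA FLOOR.**  Along a smooth
(hence, by the typing of `IsCylinderMCF`, immortal) mean curvature flow of a non-empty closed cross-section
of `N = S⁴ × ℝ`, every time slice has `μH⁴(S⁴) ≤ μH⁴(F_t(M))`; no separation and no entropy hypothesis.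
Unit lower density along the flow at lag `σ` (`helper_unitLowerDensityAlongFlow`) against the soft
large-scale bound `F̂_{p,σ} ≤ (1 + t(σ)) · area/vol` (`cylDensity_le_one_add_tail_mul`), then `σ → ∞`.
[cite: Hamilton1993, Thm. 4.1] -/
theorem helper_volLeAreaAlongCylinderFlow :
    ∀ (M : Type) [TopologicalSpace M] [T2Space M] [SecondCountableTopology M]
      [ChartedSpace (EuclideanSpace ℝ (Fin 4)) M] [IsManifold (𝓡 4) ∞ M] [CompactSpace M] [Nonempty M]
      (F : ℝ → M → EuclideanSpace ℝ (Fin 6)) (ν : ℝ → M → EuclideanSpace ℝ (Fin 6)) (T : ℝ),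
      IsCylinderMCF M F ν T → ∀ t : ℝ, T ≤ t →
        μH[4] (Metric.sphere (0 : EuclideanSpace ℝ (Fin 5)) 1) ≤ μH[4] (Set.range (F t)) := by
  intro M _ _ _ _ _ _ _ F ν T hF t ht
  set v : ℝ≥0∞ := μH[4] (Metric.sphere (0 : EuclideanSpace ℝ (Fin 5)) 1) with hv
  have hv0 : v ≠ 0 := hausdorffMeasure_sphere_four_pos.ne'
  have hvt : v ≠ ⊤ := hausdorffMeasure_sphere_four_lt_top.ne
  -- the slice lies in `N`
  have hAN : ∀ z ∈ Set.range (F t), ∑ i : Fin 5, z (Fin.castSucc i) ^ 2 = 1 := by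
    rintro _ ⟨x, rfl⟩
    exact hF.mem_cyl t ht x
  obtain ⟨x₀⟩ := ‹Nonempty M›
  -- `v ≤ (1 + t σ) · area` for every lag `σ ≥ 1`
  have key : ∀ σ : ℝ, 1 ≤ σ → v ≤ ENNReal.ofReal (1 + tail σ) * μH[4] (Set.range (F t)) := by
    intro σ hσ
    have hσ0 : 0 < σ := by linarith
    have hp : ∑ i : Fin 5, F (t + σ) x₀ (Fin.castSucc i) ^ 2 = 1 := hF.mem_cyl (t + σ) (by linarith) x₀
    have hlow : 1 ≤ cylDensity (Set.range (F t)) (F (t + σ) x₀) σ :=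
      helper_unitLowerDensityAlongFlow M F ν T hF t σ ht hσ0 x₀
    have hup : cylDensity (Set.range (F t)) (F (t + σ) x₀) σ ≤
        ENNReal.ofReal (1 + tail σ) * (v⁻¹ * μH[4] (Set.range (F t))) :=
      cylDensity_le_one_add_tail_mul hAN hp hσ
    have h1 : 1 ≤ ENNReal.ofReal (1 + tail σ) * (v⁻¹ * μH[4] (Set.range (F t))) := hlow.trans hup
    -- multiply through by `v`
    calc v = v * 1 := (mul_one v).symm
      _ ≤ v * (ENNReal.ofReal (1 + tail σ) * (v⁻¹ * μH[4] (Set.range (F t)))) := by gcongr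
      _ = ENNReal.ofReal (1 + tail σ) * μH[4] (Set.range (F t)) := by
          rw [mul_left_comm, ← mul_assoc v, ENNReal.mul_inv_cancel hv0 hvt, one_mul]
  exact le_of_forall_le_ofReal_one_add_mul tendsto_tail_atTop key

end Summit.SmoothPoincare4.SmoothPoincare4.Cruxes.CylinderRungTwo.KillingFlux

end
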